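import Summits.QuantumFields.BalabanUV.Beta.D1BFx.ColumnGaugeDefectRecord

/-!
# `BalabanUV.Beta.D1BFx.ColumnGaugePairContact` — road «BF-x», binder row D1, PART 24 HEAD §4 (b) ∕ spec v1.1 §2 (H2-Λ), (H2-M): **THE PAIR WORD `Wmix(Λ; V)` OF A
# DIAGONAL GAUGE GENERATOR WITH DECAYING LOCKED WEIGHTS AGAINST ANY FIRST-ORDER VERTEX FAMILY IS A SECOND-ORDER VERTEX FAMILY (a contact in the bond pair)** —
# `Wmix(Λ; V) μ y ν y′ := [Λ ν y′, V μ y] + [Λ μ y, V ν y′]`, `Λ μ y := diagK (z b ↦ ξ·χ_{μ,y} (legSite ρ z b))`: if `V μ y` is `BiLoc` at `(N•y, N•y)` (rate `δv`) and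
# `|ξ·χ_{μ,y} w| ≤ G·e^{−δ|w − N•y|₁}` with `δ ≤ δv`, then `Wmix(Λ; V) μ y ν y′` is `BiLoc` at `(N•y, N•y′)` with constant `4·G·e^{δ|ρ|₁}·Cv` and rate `δ∕2` — NO oscillation and
# NO window needed: the weight itself decays from the second bond.  This is the letter for the HEAD's displaced pair words that do NOT cancel at a pin: the Λ-sector word
# `W^{Λ} = Wmix(Λc; V_{S♭}) − Wmix(Λc; V_{S⁰}) = −cΛ•Wmix(Λc; V_{SΛ})` (both pins; `ChartDefectTwoPinsRoad`, `ChartDefectLiteralColumnPin`) and the mixed contacts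
# `W^{M} = Wmix(Λ; V^M)` (spec §2 (H2-M)); §3 is the RECORD's instance for the column generator `Λc` (`ξ = n⁴∕2`, `ρ_c = ctr 4 n`, locked weight `4·C₄·e^{κ′}`,
# `ColumnGaugeDefectRecord.abs_lockedWeight_record_le`) against an ARBITRARY vertex family `V` (the HEAD plugs `vertexOfK K₀ n S♭ ∕ S⁰ ∕ SΛ`, `vertexOfM K₀ n M⁰` with
# `OneStepKernelFamily.vertexFamily_vertexOfK`-class letters and its own `cΛ`).

HONEST DEPENDENCY (cell records, verbatim): «continuum YM on T⁴ ⇐ BetaPertH ∧ nine spine estimates (0/9 proved); BetaPertH ⇐ (D1) ∧ (D4) ∧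
CAP+tail; G-an2-4 gates asym, D1 and NE2/3/4.»  HONEST FRAMING (cell contract, verbatim): «discharging `BetaPertH` makes Bałaban's UV stability
UNCONDITIONAL — a real constructive-QFT result; it is NOT the continuum limit and NOT the Clay problem.»  THIS MODULE is [folklore] entrywise bookkeeping
(`ColumnGaugeDefectEnvelope.commDefect_apply`, `abs_weight_legSite_le`, `KernelWard.biLoc_add`); `V`, `χ`, `ξ`, `ρ` ARBITRARY in §1–§2.  No `def`, no `def … : Prop`,
nothing cited, NO printed hypothesis, 0 sorry.  It prices NO (1.22) row by itself; 0 root-level binders of row D1 discharged; (K) NOT closed; (J1) ONE OPEN ROW; NOT D1,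
NEVER «G-an2-4 closed», NOT `BetaPertH`, NOT continuum, NOT Clay.

ABSOLUTE RULE (cell charter, verbatim): «No internally-minted statement may enter as a cited fact. Every hypothesis is either kernel-proved in
this package or a verbatim quotation of a PUBLISHED theorem with page reference. The manuscript(s) under audit are NOT citable for their own
disputed steps — they are the thing under adjudication; programme-internal (2001/route/tribunal) claims are never citable.»

CONTENT.  §1 `biLoc_commWeight_fst` (`BiLoc ([diagK (ξχ∘legSite ρ), V]) p q …` for `V` at `(p,p)`, `χ` decaying from `q`), `biLoc_commWeight_snd` (the same at `(q,p)`),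
`biLoc_diagK_comp_of_weight` ∕ `biLoc_comp_diagK_of_weight` (the two HALF-words, both orientations — TT22's left word).
§2 `vertexFamily₂_Wmix_of_weight`.  §3 `vertexFamily₂_Wmix_record` (`d = 3`, the column generator `Λc` of the record, any `V`).
Unit `b2b-balaban-beta-d1-formalise-leaf-01` (gen 32), D1 formalisation swarm LEAF PROVER 01, road «BF-x»; OFFER O-3 of W-1 l.52359.  Not in print; our bookkeeping.
No existing file touched.
-/

noncomputable section

namespace Summit.QuantumFields.BalabanUV.Beta.D1BFx.ColumnGaugePairContact

open Literature.MathematicalPhysics.QuantumFieldTheory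
open Literature.MathematicalPhysics.QuantumFieldTheory.Balaban1983to89
open Literature.MathematicalPhysics.QuantumFieldTheory.Balaban1983to89.Beta
open B12Sec2to5 (l1 l1_nonneg)
open ExpKernelCalculus (MKer BiLoc VertexFamily VertexFamily₂ comp l1_sub_triangle l1_sub_symm)
open KernelWard (biLoc_add)
open OneStepResolventKernel (Fib biLoc_mono)
open OneStepKernelFamily (colH KInvStep)
open AffineAveraging (Site)
open AveragingContoursRooted (ctr)
open Summit.QuantumFields.BalabanUV.Beta.BorderedHessian (diagK comp_diagK_left comp_diagK_right)
open Summit.QuantumFields.BalabanUV.Beta.AxialProjectorBlockMean (bmGaugeAt)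
open Summit.QuantumFields.BalabanUV.Beta.AveragingWardRootedStencils (legSite)
open Summit.QuantumFields.BalabanUV.Beta.D1BFx.ColumnGaugeDefectEnvelope (commDefect_apply abs_weight_legSite_le exp_legSite_le)
open Summit.QuantumFields.BalabanUV.Beta.D1BFx.ColumnGaugeDefectRecord (l1_ctr_le abs_lockedWeight_record_le)
open B5Hk163Strip (kappa163 kappa163_pos)
open B5Hk163Decay (MG163)
open B4TorusKernel (periodConst)

variable {d : ℕ}

/-! ## §1 A diagonal decaying weight against a kernel bi-localised at one point -/

/-- [folklore] The locked weight read at a leg site, centred at `q`: `|ξ·χ (legSite ρ x a)| ≤ G·e^{δ|ρ|₁}·e^{−δ|x − q|₁}` from `|ξ·χ w| ≤ G·e^{−δ|w − q|₁}`. -/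
theorem abs_locked_legSite_le {χ : Site (d + 1) → ℝ} {ξ G δ : ℝ} {q : Site (d + 1)} (hG : 0 ≤ G) (hδ : 0 ≤ δ)
    (hg : ∀ w, |ξ * χ w| ≤ G * Real.exp (-δ * l1 (w - q))) (ρ x : Site (d + 1)) (a : Fib d) :
    |ξ * χ (legSite ρ x a)| ≤ G * Real.exp (δ * l1 ρ) * Real.exp (-δ * l1 (x - q)) :=
  (hg _).trans (by rw [mul_assoc]; exact mul_le_mul_of_nonneg_left (exp_legSite_le hδ ρ x q a) hG)

/-- [folklore] **FIRST ORIENTATION**: `V` bi-localised at `(p, p)` with rate `δv`, the locked weight `ξ·χ` decaying from `q` with rate `δ ≤ δv` ⟹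
`BiLoc ([diagK (ξ·χ∘legSite ρ), V]) p q (2·G·e^{δ|ρ|₁}·Cv) (δ∕2)` — entries `(ξχ(x̃) − ξχ(z̃))·V x z a b`: the `z̃`-term decays from `q` directly, the `x̃`-term through
`|z − q|₁ ≤ |z − p|₁ + |x − p|₁ + |x − q|₁`. -/
theorem biLoc_commWeight_fst {V : MKer (d + 1) (Fib d)} {p q : Site (d + 1)} {Cv δv G δ : ℝ} {χ : Site (d + 1) → ℝ} {ξ : ℝ}
    (hV : BiLoc V p p Cv δv) (hCv : 0 ≤ Cv) (hG : 0 ≤ G) (hδ : 0 ≤ δ) (hδv : δ ≤ δv)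
    (hg : ∀ w, |ξ * χ w| ≤ G * Real.exp (-δ * l1 (w - q))) (ρ : Site (d + 1)) :
    BiLoc (comp (diagK fun z b => ξ * χ (legSite ρ z b)) V - comp V (diagK fun z b => ξ * χ (legSite ρ z b))) p q
      (2 * (G * Real.exp (δ * l1 ρ)) * Cv) (δ / 2) := by
  intro x z a b
  rw [commDefect_apply, abs_mul]
  have hx := abs_locked_legSite_le hG hδ hg ρ x a
  have hz := abs_locked_legSite_le hG hδ hg ρ z b
  have hv := hV x z a b
  have t1 : l1 (z - q) ≤ l1 (z - x) + l1 (x - q) := l1_sub_triangle z x q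
  have t2 : l1 (z - x) ≤ l1 (z - p) + l1 (p - x) := l1_sub_triangle z p x
  rw [l1_sub_symm p x] at t2
  have hxp := l1_nonneg (x - p)
  have hzp := l1_nonneg (z - p)
  have hxq := l1_nonneg (x - q)
  have hzq := l1_nonneg (z - q)
  -- the two products of exponentials against the target `e^{−(δ/2)(|x−p| + |z−q|)}`
  have e1 : Real.exp (-δ * l1 (x - q)) * Real.exp (-δv * (l1 (x - p) + l1 (z - p))) ≤ Real.exp (-(δ / 2) * (l1 (x - p) + l1 (z - q))) := by
    rw [← Real.exp_add]; exact Real.exp_le_exp.2 (by nlinarith)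
  have e2 : Real.exp (-δ * l1 (z - q)) * Real.exp (-δv * (l1 (x - p) + l1 (z - p))) ≤ Real.exp (-(δ / 2) * (l1 (x - p) + l1 (z - q))) := by
    rw [← Real.exp_add]; exact Real.exp_le_exp.2 (by nlinarith)
  have hsub : |ξ * χ (legSite ρ x a) - ξ * χ (legSite ρ z b)| ≤ G * Real.exp (δ * l1 ρ) * (Real.exp (-δ * l1 (x - q)) + Real.exp (-δ * l1 (z - q))) := by
    refine (abs_sub _ _).trans ?_
    rw [mul_add]
    exact add_le_add hx hz
  have hA : 0 ≤ G * Real.exp (δ * l1 ρ) := by positivity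
  calc |ξ * χ (legSite ρ x a) - ξ * χ (legSite ρ z b)| * |V x z a b|
      ≤ (G * Real.exp (δ * l1 ρ) * (Real.exp (-δ * l1 (x - q)) + Real.exp (-δ * l1 (z - q)))) * (Cv * Real.exp (-δv * (l1 (x - p) + l1 (z - p)))) :=
        mul_le_mul hsub hv (abs_nonneg _) (by positivity)
    _ = G * Real.exp (δ * l1 ρ) * Cv * (Real.exp (-δ * l1 (x - q)) * Real.exp (-δv * (l1 (x - p) + l1 (z - p)))
          + Real.exp (-δ * l1 (z - q)) * Real.exp (-δv * (l1 (x - p) + l1 (z - p)))) := by ring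
    _ ≤ G * Real.exp (δ * l1 ρ) * Cv * (Real.exp (-(δ / 2) * (l1 (x - p) + l1 (z - q))) + Real.exp (-(δ / 2) * (l1 (x - p) + l1 (z - q)))) :=
        mul_le_mul_of_nonneg_left (add_le_add e1 e2) (by positivity)
    _ = _ := by ring

/-- [folklore] **SECOND ORIENTATION**: under the same hypotheses `BiLoc ([diagK (ξ·χ∘legSite ρ), V]) q p (2·G·e^{δ|ρ|₁}·Cv) (δ∕2)` (the `x̃`-term decays from `q` directly, the
`z̃`-term through `|x − q|₁ ≤ |x − p|₁ + |z − p|₁ + |z − q|₁`). -/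
theorem biLoc_commWeight_snd {V : MKer (d + 1) (Fib d)} {p q : Site (d + 1)} {Cv δv G δ : ℝ} {χ : Site (d + 1) → ℝ} {ξ : ℝ}
    (hV : BiLoc V p p Cv δv) (hCv : 0 ≤ Cv) (hG : 0 ≤ G) (hδ : 0 ≤ δ) (hδv : δ ≤ δv)
    (hg : ∀ w, |ξ * χ w| ≤ G * Real.exp (-δ * l1 (w - q))) (ρ : Site (d + 1)) :
    BiLoc (comp (diagK fun z b => ξ * χ (legSite ρ z b)) V - comp V (diagK fun z b => ξ * χ (legSite ρ z b))) q p
      (2 * (G * Real.exp (δ * l1 ρ)) * Cv) (δ / 2) := by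
  intro x z a b
  rw [commDefect_apply, abs_mul]
  have hx := abs_locked_legSite_le hG hδ hg ρ x a
  have hz := abs_locked_legSite_le hG hδ hg ρ z b
  have hv := hV x z a b
  have t1 : l1 (x - q) ≤ l1 (x - z) + l1 (z - q) := l1_sub_triangle x z q
  have t2 : l1 (x - z) ≤ l1 (x - p) + l1 (p - z) := l1_sub_triangle x p z
  rw [l1_sub_symm p z] at t2
  have hxp := l1_nonneg (x - p)
  have hzp := l1_nonneg (z - p)
  have hxq := l1_nonneg (x - q)
  have hzq := l1_nonneg (z - q)
  have e1 : Real.exp (-δ * l1 (x - q)) * Real.exp (-δv * (l1 (x - p) + l1 (z - p))) ≤ Real.exp (-(δ / 2) * (l1 (x - q) + l1 (z - p))) := by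
    rw [← Real.exp_add]; exact Real.exp_le_exp.2 (by nlinarith)
  have e2 : Real.exp (-δ * l1 (z - q)) * Real.exp (-δv * (l1 (x - p) + l1 (z - p))) ≤ Real.exp (-(δ / 2) * (l1 (x - q) + l1 (z - p))) := by
    rw [← Real.exp_add]; exact Real.exp_le_exp.2 (by nlinarith)
  have hsub : |ξ * χ (legSite ρ x a) - ξ * χ (legSite ρ z b)| ≤ G * Real.exp (δ * l1 ρ) * (Real.exp (-δ * l1 (x - q)) + Real.exp (-δ * l1 (z - q))) := by
    refine (abs_sub _ _).trans ?_
    rw [mul_add]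
    exact add_le_add hx hz
  have hA : 0 ≤ G * Real.exp (δ * l1 ρ) := by positivity
  calc |ξ * χ (legSite ρ x a) - ξ * χ (legSite ρ z b)| * |V x z a b|
      ≤ (G * Real.exp (δ * l1 ρ) * (Real.exp (-δ * l1 (x - q)) + Real.exp (-δ * l1 (z - q)))) * (Cv * Real.exp (-δv * (l1 (x - p) + l1 (z - p)))) :=
        mul_le_mul hsub hv (abs_nonneg _) (by positivity)
    _ = G * Real.exp (δ * l1 ρ) * Cv * (Real.exp (-δ * l1 (x - q)) * Real.exp (-δv * (l1 (x - p) + l1 (z - p)))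
          + Real.exp (-δ * l1 (z - q)) * Real.exp (-δv * (l1 (x - p) + l1 (z - p)))) := by ring
    _ ≤ G * Real.exp (δ * l1 ρ) * Cv * (Real.exp (-(δ / 2) * (l1 (x - q) + l1 (z - p))) + Real.exp (-(δ / 2) * (l1 (x - q) + l1 (z - p)))) :=
        mul_le_mul_of_nonneg_left (add_le_add e1 e2) (by positivity)
    _ = _ := by ring

/-- [folklore] **THE LEFT HALF-WORD `diagK (ξ·χ∘legSite ρ) ∘ V` IS A CONTACT IN THE PAIR, BOTH ORIENTATIONS** (the shape of the left word of leaf-03 g31's TT22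
`DressedMixVertexSiteSplit.mixOfK_coDressKBmAt_eq_of_siteLetter`): under the hypotheses of `biLoc_commWeight_fst`,
`BiLoc (diagK (ξ·χ∘legSite ρ) ∘ V) p q (G·e^{δ|ρ|₁}·Cv) (δ∕2)` and `BiLoc (…) q p (G·e^{δ|ρ|₁}·Cv) (δ∕2)` (entries `ξχ(x̃)·V x z a b`). -/
theorem biLoc_diagK_comp_of_weight {V : MKer (d + 1) (Fib d)} {p q : Site (d + 1)} {Cv δv G δ : ℝ} {χ : Site (d + 1) → ℝ} {ξ : ℝ}
    (hV : BiLoc V p p Cv δv) (hCv : 0 ≤ Cv) (hG : 0 ≤ G) (hδ : 0 ≤ δ) (hδv : δ ≤ δv)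
    (hg : ∀ w, |ξ * χ w| ≤ G * Real.exp (-δ * l1 (w - q))) (ρ : Site (d + 1)) :
    BiLoc (comp (diagK fun z b => ξ * χ (legSite ρ z b)) V) p q (G * Real.exp (δ * l1 ρ) * Cv) (δ / 2)
      ∧ BiLoc (comp (diagK fun z b => ξ * χ (legSite ρ z b)) V) q p (G * Real.exp (δ * l1 ρ) * Cv) (δ / 2) := by
  have key : ∀ x z a b, |comp (diagK fun z b => ξ * χ (legSite ρ z b)) V x z a b|
      ≤ G * Real.exp (δ * l1 ρ) * Cv * (Real.exp (-δ * l1 (x - q)) * Real.exp (-δv * (l1 (x - p) + l1 (z - p)))) := fun x z a b => by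
    rw [comp_diagK_left, abs_mul]
    calc |ξ * χ (legSite ρ x a)| * |V x z a b|
        ≤ (G * Real.exp (δ * l1 ρ) * Real.exp (-δ * l1 (x - q))) * (Cv * Real.exp (-δv * (l1 (x - p) + l1 (z - p)))) :=
          mul_le_mul (abs_locked_legSite_le hG hδ hg ρ x a) (hV x z a b) (abs_nonneg _) (by positivity)
      _ = _ := by ring
  have hA : 0 ≤ G * Real.exp (δ * l1 ρ) * Cv := by positivity
  refine ⟨fun x z a b => (key x z a b).trans (mul_le_mul_of_nonneg_left ?_ hA),
    fun x z a b => (key x z a b).trans (mul_le_mul_of_nonneg_left ?_ hA)⟩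
  · have t1 : l1 (z - q) ≤ l1 (z - x) + l1 (x - q) := l1_sub_triangle z x q
    have t2 : l1 (z - x) ≤ l1 (z - p) + l1 (p - x) := l1_sub_triangle z p x
    rw [l1_sub_symm p x] at t2
    have hxp := l1_nonneg (x - p); have hzp := l1_nonneg (z - p); have hxq := l1_nonneg (x - q)
    rw [← Real.exp_add]; exact Real.exp_le_exp.2 (by nlinarith)
  · have hxp := l1_nonneg (x - p); have hzp := l1_nonneg (z - p); have hxq := l1_nonneg (x - q)
    rw [← Real.exp_add]; exact Real.exp_le_exp.2 (by nlinarith)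

/-- [folklore] **THE RIGHT HALF-WORD `V ∘ diagK (ξ·χ∘legSite ρ)` IS A CONTACT IN THE PAIR, BOTH ORIENTATIONS**: under the same hypotheses,
`BiLoc (V ∘ diagK (ξ·χ∘legSite ρ)) p q (G·e^{δ|ρ|₁}·Cv) (δ∕2)` and `BiLoc (…) q p (G·e^{δ|ρ|₁}·Cv) (δ∕2)` (entries `V x z a b·ξχ(z̃)`). -/
theorem biLoc_comp_diagK_of_weight {V : MKer (d + 1) (Fib d)} {p q : Site (d + 1)} {Cv δv G δ : ℝ} {χ : Site (d + 1) → ℝ} {ξ : ℝ}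
    (hV : BiLoc V p p Cv δv) (hCv : 0 ≤ Cv) (hG : 0 ≤ G) (hδ : 0 ≤ δ) (hδv : δ ≤ δv)
    (hg : ∀ w, |ξ * χ w| ≤ G * Real.exp (-δ * l1 (w - q))) (ρ : Site (d + 1)) :
    BiLoc (comp V (diagK fun z b => ξ * χ (legSite ρ z b))) p q (G * Real.exp (δ * l1 ρ) * Cv) (δ / 2)
      ∧ BiLoc (comp V (diagK fun z b => ξ * χ (legSite ρ z b))) q p (G * Real.exp (δ * l1 ρ) * Cv) (δ / 2) := by
  have key : ∀ x z a b, |comp V (diagK fun z b => ξ * χ (legSite ρ z b)) x z a b|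
      ≤ G * Real.exp (δ * l1 ρ) * Cv * (Real.exp (-δ * l1 (z - q)) * Real.exp (-δv * (l1 (x - p) + l1 (z - p)))) := fun x z a b => by
    rw [comp_diagK_right, abs_mul]
    calc |V x z a b| * |ξ * χ (legSite ρ z b)|
        ≤ (Cv * Real.exp (-δv * (l1 (x - p) + l1 (z - p)))) * (G * Real.exp (δ * l1 ρ) * Real.exp (-δ * l1 (z - q))) :=
          mul_le_mul (hV x z a b) (abs_locked_legSite_le hG hδ hg ρ z b) (abs_nonneg _) (by positivity)
      _ = _ := by ring
  have hA : 0 ≤ G * Real.exp (δ * l1 ρ) * Cv := by positivity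
  refine ⟨fun x z a b => (key x z a b).trans (mul_le_mul_of_nonneg_left ?_ hA),
    fun x z a b => (key x z a b).trans (mul_le_mul_of_nonneg_left ?_ hA)⟩
  · have hxp := l1_nonneg (x - p); have hzp := l1_nonneg (z - p); have hzq := l1_nonneg (z - q)
    rw [← Real.exp_add]; exact Real.exp_le_exp.2 (by nlinarith)
  · have t1 : l1 (x - q) ≤ l1 (x - z) + l1 (z - q) := l1_sub_triangle x z q
    have t2 : l1 (x - z) ≤ l1 (x - p) + l1 (p - z) := l1_sub_triangle x p z
    rw [l1_sub_symm p z] at t2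
    have hxp := l1_nonneg (x - p); have hzp := l1_nonneg (z - p); have hzq := l1_nonneg (z - q)
    rw [← Real.exp_add]; exact Real.exp_le_exp.2 (by nlinarith)

/-! ## §2 The pair word `Wmix(Λ; V)` of vertex families -/

/-- [folklore] **`Wmix(Λ; V)` IS A SECOND-ORDER VERTEX FAMILY**: for a first-order vertex family `V` at blocking `N` (`BiLoc (V μ y) (N•y) (N•y) Cv δv`) and a family of
locked weights `|ξ·χ_{μ,y} w| ≤ G·e^{−δ|w − N•y|₁}` with `δ ≤ δv`, the pair word `μ y ν y′ ↦ [Λ ν y′, V μ y] + [Λ μ y, V ν y′]` (`Λ μ y := diagK (z b ↦ ξ·χ_{μ,y} (legSite ρ z b))`) is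
`VertexFamily₂` at blocking `N` with constant `4·G·e^{δ|ρ|₁}·Cv` and rate `δ∕2`. -/
theorem vertexFamily₂_Wmix_of_weight {V : Fin (d + 1) → Site (d + 1) → MKer (d + 1) (Fib d)} {N : ℕ} {Cv δv G δ : ℝ}
    (hV : VertexFamily V N Cv δv) (hCv : 0 ≤ Cv) (hG : 0 ≤ G) (hδ : 0 ≤ δ) (hδv : δ ≤ δv)
    {χ : Fin (d + 1) → Site (d + 1) → Site (d + 1) → ℝ} {ξ : ℝ} (hg : ∀ μ y w, |ξ * χ μ y w| ≤ G * Real.exp (-δ * l1 (w - (N : ℤ) • y))) (ρ : Site (d + 1)) :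
    VertexFamily₂ (fun μ y ν y' =>
        (comp (diagK fun z b => ξ * χ ν y' (legSite ρ z b)) (V μ y) - comp (V μ y) (diagK fun z b => ξ * χ ν y' (legSite ρ z b)))
          + (comp (diagK fun z b => ξ * χ μ y (legSite ρ z b)) (V ν y') - comp (V ν y') (diagK fun z b => ξ * χ μ y (legSite ρ z b)))) N
      (2 * (G * Real.exp (δ * l1 ρ)) * Cv + 2 * (G * Real.exp (δ * l1 ρ)) * Cv) (δ / 2) :=
  fun μ y ν y' => biLoc_add (biLoc_commWeight_fst (hV μ y) hCv hG hδ hδv (hg ν y') ρ) (biLoc_commWeight_snd (hV ν y') hCv hG hδ hδv (hg μ y) ρ)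

/-! ## §3 The record's column generator `Λc` against an arbitrary vertex family -/

/-- **`Wmix(Λc; V)` AT THE RECORD IS A SECOND-ORDER VERTEX FAMILY, CONSTANT DISPLAYED** [our objects + folklore]: for `1 ≤ n`, the record's column generator
`Λc μ y := diagK (z b ↦ (n⁴∕2)·bmGaugeAt ρ_c (colH K₀ n μ y) n (legSite ρ_c z b))` (`K₀ := KInvStep 3 n 0`, `ρ_c := ctr 4 n`; locked weight `≤ 4·C₄·e^{κ′}·e^{−(κ′∕(4n))|w − n•y|₁}`,
`ColumnGaugeDefectRecord.abs_lockedWeight_record_le`) and ANY first-order vertex family `V` at blocking `n` with rate `δv ≥ κ′∕(4n)` and constant `Cv ≥ 0`: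
`VertexFamily₂ (Wmix(Λc; V)) n (16·C₄·e^{(3∕2)κ′}·Cv) (κ₁₆₃(4)∕(32n))` (`|ρ_c|₁ ≤ 2n` costs `e^{κ′∕2}`).  The HEAD plugs `V := vertexOfK K₀ n S♭ ∕ S⁰ ∕ SΛ` (the Λ-sector word
`W^{Λ}`, with its own `cΛ`) or `vertexOfM K₀ n M⁰` (the mixed contacts `W^{M}`). -/
theorem vertexFamily₂_Wmix_record {n : ℕ} [NeZero n] (hn : 1 ≤ n) {V : Fin (3 + 1) → Site (3 + 1) → MKer (3 + 1) (Fib 3)} {Cv δv : ℝ}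
    (hV : VertexFamily V n Cv δv) (hCv : 0 ≤ Cv) (hδv : kappa163 (3 + 1) / ((3 : ℝ) + 1) / (((3 : ℝ) + 1) * n) ≤ δv) :
    VertexFamily₂ (fun μ y ν y' =>
        (comp (diagK fun z' b => (n : ℝ) ^ 4 / 2 * bmGaugeAt (ctr 4 n) (colH (KInvStep (d := 3) n 0) n ν y') n (legSite (ctr 4 n) z' b)) (V μ y)
            - comp (V μ y) (diagK fun z' b => (n : ℝ) ^ 4 / 2 * bmGaugeAt (ctr 4 n) (colH (KInvStep (d := 3) n 0) n ν y') n (legSite (ctr 4 n) z' b)))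
          + (comp (diagK fun z' b => (n : ℝ) ^ 4 / 2 * bmGaugeAt (ctr 4 n) (colH (KInvStep (d := 3) n 0) n μ y) n (legSite (ctr 4 n) z' b)) (V ν y')
            - comp (V ν y') (diagK fun z' b => (n : ℝ) ^ 4 / 2 * bmGaugeAt (ctr 4 n) (colH (KInvStep (d := 3) n 0) n μ y) n (legSite (ctr 4 n) z' b)))) n
      (16 * (MG163 (3 + 1) * periodConst (kappa163 (3 + 1)) 3) * Real.exp (3 / 2 * (kappa163 (3 + 1) / ((3 : ℝ) + 1))) * Cv)
      (kappa163 (3 + 1) / (32 * n)) := by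
  have hn0 : (0 : ℝ) < n := by exact_mod_cast hn
  have hc : 0 ≤ kappa163 (3 + 1) / ((3 : ℝ) + 1) := (div_pos (kappa163_pos (3 + 1)) (by positivity)).le
  have hδ : 0 ≤ kappa163 (3 + 1) / ((3 : ℝ) + 1) / (((3 : ℝ) + 1) * n) := by positivity
  have hg := fun (μ : Fin (3 + 1)) (y w : Site (3 + 1)) => abs_lockedWeight_record_le (n := n) hn μ y w
  have hC₄ : 0 ≤ MG163 (3 + 1) * periodConst (kappa163 (3 + 1)) 3 := by
    have h := (abs_nonneg _).trans (hg 0 0 0)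
    have h1 : 0 ≤ 4 * (MG163 (3 + 1) * periodConst (kappa163 (3 + 1)) 3) * Real.exp (kappa163 (3 + 1) / ((3 : ℝ) + 1)) :=
      (mul_nonneg_iff_of_pos_right (Real.exp_pos _)).1 h
    have h2 : 0 ≤ 4 * (MG163 (3 + 1) * periodConst (kappa163 (3 + 1)) 3) := (mul_nonneg_iff_of_pos_right (Real.exp_pos _)).1 h1
    linarith
  have hG : 0 ≤ 4 * (MG163 (3 + 1) * periodConst (kappa163 (3 + 1)) 3) * Real.exp (kappa163 (3 + 1) / ((3 : ℝ) + 1)) := by positivity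
  have h := vertexFamily₂_Wmix_of_weight hV hCv hG hδ hδv (ξ := (n : ℝ) ^ 4 / 2)
    (χ := fun μ y w => bmGaugeAt (ctr 4 n) (colH (KInvStep (d := 3) n 0) n μ y) n w) hg (ctr 4 n)
  have hrate : kappa163 (3 + 1) / (32 * n) ≤ kappa163 (3 + 1) / ((3 : ℝ) + 1) / (((3 : ℝ) + 1) * n) / 2 := le_of_eq (by field_simp; ring)
  intro μ y ν y' x z a b
  refine ((biLoc_mono (h μ y ν y') (by positivity) hrate) x z a b).trans (mul_le_mul_of_nonneg_right ?_ (Real.exp_pos _).le)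
  -- the constant: `4·(4C₄e^{κ′}·e^{δ|ρ_c|₁})·Cv ≤ 16·C₄·e^{3κ′∕2}·Cv`
  have hρ : kappa163 (3 + 1) / ((3 : ℝ) + 1) / (((3 : ℝ) + 1) * n) * l1 (ctr 4 n) ≤ kappa163 (3 + 1) / ((3 : ℝ) + 1) / 2 := by
    have h4 := l1_ctr_le 3 n
    calc kappa163 (3 + 1) / ((3 : ℝ) + 1) / (((3 : ℝ) + 1) * n) * l1 (ctr 4 n)
        ≤ kappa163 (3 + 1) / ((3 : ℝ) + 1) / (((3 : ℝ) + 1) * n) * ((((3 : ℕ) : ℝ) + 1) * n / 2) := mul_le_mul_of_nonneg_left h4 hδ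
      _ = kappa163 (3 + 1) / ((3 : ℝ) + 1) / 2 := by push_cast; field_simp
  have e1 : Real.exp (kappa163 (3 + 1) / ((3 : ℝ) + 1) / (((3 : ℝ) + 1) * n) * l1 (ctr 4 n)) ≤ Real.exp (kappa163 (3 + 1) / ((3 : ℝ) + 1) / 2) :=
    Real.exp_le_exp.2 hρ
  set C₄ : ℝ := MG163 (3 + 1) * periodConst (kappa163 (3 + 1)) 3 with hC₄def
  set κ' : ℝ := kappa163 (3 + 1) / ((3 : ℝ) + 1) with hκ'def
  calc 2 * (4 * C₄ * Real.exp κ' * Real.exp (κ' / (((3 : ℝ) + 1) * n) * l1 (ctr 4 n))) * Cv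
        + 2 * (4 * C₄ * Real.exp κ' * Real.exp (κ' / (((3 : ℝ) + 1) * n) * l1 (ctr 4 n))) * Cv
      = 16 * C₄ * Cv * (Real.exp κ' * Real.exp (κ' / (((3 : ℝ) + 1) * n) * l1 (ctr 4 n))) := by ring
    _ ≤ 16 * C₄ * Cv * (Real.exp κ' * Real.exp (κ' / 2)) := by
        have hA : 0 ≤ 16 * C₄ * Cv := by positivity
        exact mul_le_mul_of_nonneg_left (mul_le_mul_of_nonneg_left e1 (Real.exp_pos _).le) hA
    _ = _ := by rw [← Real.exp_add]; ring_nf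

/-! ## §4 (v1.2, append-only) The record instance at the CONSUMER's rate

gan24-leaf-05 g62 (INTENT-1 «K0-VF-PACK» l.53507, located): a `VertexFamily` letter for `vertexOfK K₀ n S` built from the straight column at fine rate `κ′∕(4n)`
(`biLoc_wsum`) reaches both legs only at rate `≤ κ′∕(8n)`, so §3's hypothesis `κ′∕(4n) ≤ δv` is not met by the HEAD's families; the instance the HEAD consumes weakens
the LOCKED WEIGHT's rate to the family's `δv ≤ κ′∕(4n)` instead (monotonicity of the envelope), same constant. -/

/-- **`Wmix(Λc; V)` AT THE RECORD, AT THE VERTEX FAMILY's OWN RATE** [our objects + folklore]: for `1 ≤ n`, ANY first-order vertex family `V` at blocking `n` with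
constant `Cv ≥ 0` and rate `0 ≤ δv ≤ κ′∕(4n)`: `VertexFamily₂ (Wmix(Λc; V)) n (16·C₄·e^{(3∕2)κ′}·Cv) (δv∕2)` — §2 with the locked weight
`|(n⁴∕2)·χ_{μ,y} w| ≤ 4·C₄·e^{κ′}·e^{−(κ′∕(4n))|w − n•y|₁} ≤ 4·C₄·e^{κ′}·e^{−δv|w − n•y|₁}` read at the weaker rate (`|ρ_c|₁ ≤ 2n` still costs at most `e^{κ′∕2}`). -/
theorem vertexFamily₂_Wmix_record_of_rate_le {n : ℕ} [NeZero n] (hn : 1 ≤ n) {V : Fin (3 + 1) → Site (3 + 1) → MKer (3 + 1) (Fib 3)} {Cv δv : ℝ}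
    (hV : VertexFamily V n Cv δv) (hCv : 0 ≤ Cv) (hδv0 : 0 ≤ δv) (hδv : δv ≤ kappa163 (3 + 1) / ((3 : ℝ) + 1) / (((3 : ℝ) + 1) * n)) :
    VertexFamily₂ (fun μ y ν y' =>
        (comp (diagK fun z' b => (n : ℝ) ^ 4 / 2 * bmGaugeAt (ctr 4 n) (colH (KInvStep (d := 3) n 0) n ν y') n (legSite (ctr 4 n) z' b)) (V μ y)
            - comp (V μ y) (diagK fun z' b => (n : ℝ) ^ 4 / 2 * bmGaugeAt (ctr 4 n) (colH (KInvStep (d := 3) n 0) n ν y') n (legSite (ctr 4 n) z' b)))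
          + (comp (diagK fun z' b => (n : ℝ) ^ 4 / 2 * bmGaugeAt (ctr 4 n) (colH (KInvStep (d := 3) n 0) n μ y) n (legSite (ctr 4 n) z' b)) (V ν y')
            - comp (V ν y') (diagK fun z' b => (n : ℝ) ^ 4 / 2 * bmGaugeAt (ctr 4 n) (colH (KInvStep (d := 3) n 0) n μ y) n (legSite (ctr 4 n) z' b)))) n
      (16 * (MG163 (3 + 1) * periodConst (kappa163 (3 + 1)) 3) * Real.exp (3 / 2 * (kappa163 (3 + 1) / ((3 : ℝ) + 1))) * Cv)
      (δv / 2) := by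
  have hn0 : (0 : ℝ) < n := by exact_mod_cast hn
  have hc : 0 ≤ kappa163 (3 + 1) / ((3 : ℝ) + 1) := (div_pos (kappa163_pos (3 + 1)) (by positivity)).le
  have hg0 := fun (μ : Fin (3 + 1)) (y w : Site (3 + 1)) => abs_lockedWeight_record_le (n := n) hn μ y w
  have hC₄ : 0 ≤ MG163 (3 + 1) * periodConst (kappa163 (3 + 1)) 3 := by
    have h := (abs_nonneg _).trans (hg0 0 0 0)
    have h1 : 0 ≤ 4 * (MG163 (3 + 1) * periodConst (kappa163 (3 + 1)) 3) * Real.exp (kappa163 (3 + 1) / ((3 : ℝ) + 1)) :=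
      (mul_nonneg_iff_of_pos_right (Real.exp_pos _)).1 h
    have h2 : 0 ≤ 4 * (MG163 (3 + 1) * periodConst (kappa163 (3 + 1)) 3) := (mul_nonneg_iff_of_pos_right (Real.exp_pos _)).1 h1
    linarith
  have hG : 0 ≤ 4 * (MG163 (3 + 1) * periodConst (kappa163 (3 + 1)) 3) * Real.exp (kappa163 (3 + 1) / ((3 : ℝ) + 1)) := by positivity
  -- the locked weight read at the weaker rate `δv`
  have hg : ∀ (μ : Fin (3 + 1)) (y w : Site (3 + 1)),
      |(n : ℝ) ^ 4 / 2 * bmGaugeAt (ctr 4 n) (colH (KInvStep (d := 3) n 0) n μ y) n w|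
        ≤ 4 * (MG163 (3 + 1) * periodConst (kappa163 (3 + 1)) 3) * Real.exp (kappa163 (3 + 1) / ((3 : ℝ) + 1)) * Real.exp (-δv * l1 (w - (n : ℤ) • y)) :=
    fun μ y w => (hg0 μ y w).trans (mul_le_mul_of_nonneg_left (Real.exp_le_exp.2 (by nlinarith [l1_nonneg (w - (n : ℤ) • y)])) hG)
  have h := vertexFamily₂_Wmix_of_weight hV hCv hG hδv0 le_rfl (ξ := (n : ℝ) ^ 4 / 2)
    (χ := fun μ y w => bmGaugeAt (ctr 4 n) (colH (KInvStep (d := 3) n 0) n μ y) n w) hg (ctr 4 n)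
  intro μ y ν y' x z a b
  refine ((h μ y ν y') x z a b).trans (mul_le_mul_of_nonneg_right ?_ (Real.exp_pos _).le)
  -- the constant: `4·(4C₄e^{κ′}·e^{δv|ρ_c|₁})·Cv ≤ 16·C₄·e^{3κ′∕2}·Cv` since `δv|ρ_c|₁ ≤ (κ′∕(4n))·2n = κ′∕2`
  have hρ : δv * l1 (ctr 4 n) ≤ kappa163 (3 + 1) / ((3 : ℝ) + 1) / 2 := by
    have h4 := l1_ctr_le 3 n
    have hl0 := l1_nonneg (ctr 4 n)
    calc δv * l1 (ctr 4 n) ≤ kappa163 (3 + 1) / ((3 : ℝ) + 1) / (((3 : ℝ) + 1) * n) * l1 (ctr 4 n) := mul_le_mul_of_nonneg_right hδv hl0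
      _ ≤ kappa163 (3 + 1) / ((3 : ℝ) + 1) / (((3 : ℝ) + 1) * n) * ((((3 : ℕ) : ℝ) + 1) * n / 2) := mul_le_mul_of_nonneg_left h4 (by positivity)
      _ = kappa163 (3 + 1) / ((3 : ℝ) + 1) / 2 := by push_cast; field_simp
  have e1 : Real.exp (δv * l1 (ctr 4 n)) ≤ Real.exp (kappa163 (3 + 1) / ((3 : ℝ) + 1) / 2) := Real.exp_le_exp.2 hρ
  set C₄ : ℝ := MG163 (3 + 1) * periodConst (kappa163 (3 + 1)) 3 with hC₄def
  set κ' : ℝ := kappa163 (3 + 1) / ((3 : ℝ) + 1) with hκ'def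
  calc 2 * (4 * C₄ * Real.exp κ' * Real.exp (δv * l1 (ctr 4 n))) * Cv + 2 * (4 * C₄ * Real.exp κ' * Real.exp (δv * l1 (ctr 4 n))) * Cv
      = 16 * C₄ * Cv * (Real.exp κ' * Real.exp (δv * l1 (ctr 4 n))) := by ring
    _ ≤ 16 * C₄ * Cv * (Real.exp κ' * Real.exp (κ' / 2)) := by
        have hA : 0 ≤ 16 * C₄ * Cv := by positivity
        exact mul_le_mul_of_nonneg_left (mul_le_mul_of_nonneg_left e1 (Real.exp_pos _).le) hA
    _ = _ := by rw [← Real.exp_add]; ring_nf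

end Summit.QuantumFields.BalabanUV.Beta.D1BFx.ColumnGaugePairContact

end
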